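import Literature.Analysis.FluidPDE.ForcedFourierDuhamelDefs
import Literature.Analysis.FluidPDE.FourierL2PicardClass
import HarnessLib

/-!
# The forcing term of the Fourier–Duhamel formula: class, decay and the `X¹/X²`-type bounds

Second file of the FORCED twin of the weighted-`L²` Fourier-side construction of the local smooth
solution of the Navier–Stokes system (definitions in `ForcedFourierDuhamelDefs`; homogeneous
chain `FourierL2Convolution → … → FourierL2PicardLimit`; source: T. Tao, Anal. PDE 6 (2013) =
arXiv:1108.1165, Thm. 5.4 (ii) = arXiv Thm. 31 (ii), p. 18, proved WITH forcing "by repeating the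
proof of Theorem 28 verbatim", i.e. by the contraction of the forced Duhamel map in
`X¹ = L^∞_t H¹_x ∩ L²_t H²_x` through the energy estimate of Lemma 2.1 = arXiv Lemma 23,

  `‖e^{tΔ}u₀ + ∫₀ᵗ e^{(t-t')Δ} F(t') dt'‖_{X^s} ≲ ‖u₀‖_{H^s} + ‖F‖_{L¹_t H^s_x}`   (energy-duh2)).

For force coefficients `b : ℝ → E → ℂ^ι` that are **jointly continuous with pointwise polynomial
decay of every order, uniformly in time** (the Fourier image, clamped in time, of Tao's Schwartz
force on the slab; this is exactly the qualitative class `HasDecay` of the Duhamel parts `E_n` of the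
homogeneous Picard iterates, `FourierL2PicardClass`) this file proves, for the forcing term
`F = forcing c T b` (`F(t, ξ) = ∫₀^τ e^{-c‖ξ‖²(τ-s)} b(s, ξ) ds`, `τ = clamp T t`):

* `continuous_forcing`, `hasDecay_forcing`, `exists_hasDecay_forcing` — `F` is jointly continuous on
  `ℝ × E` and has pointwise decay of every order uniformly in time (`‖F(t,ξ)‖ ≤ T·B_K(1+‖ξ‖)^{-K}`),
  so the forced iterates `w_n = h + F − E_n` are trajectories `h − (E_n − F)` of the class of
  `FourierL2PicardClass`;
* `sum_mul_forcing`, `forcing_conj_symm` — the divergence-free symbol relation and the conjugation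
  symmetry pass from `b` to `F`;
* `enorm_forcing_le_lintegral` (`‖F(t,ξ)‖ₑ ≤ ∫⁻_{(0,T]} ‖b(s,ξ)‖ₑ ds`) and the heat gain
  `norm_sq_mul_enorm_forcing_sq_le` (`‖ξ‖² ‖F(t,ξ)‖ₑ² ≤ (2c)⁻¹ ∫⁻_{(0,T]} ‖b(s,ξ)‖ₑ² ds` — the tree's
  `enorm_duhamel_sq_le`, Cauchy–Schwarz in time against `2c‖ξ‖²∫heat² ≤ 1`: the Fourier side of
  (energy-duh2) for the force term);
* the integrated bounds entering the forced `X¹/X²` recursion (`ForcedFourierPicardBounds`):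
  `lintegral_weight_majorant_forcing_sq_le` — `∫⁻ (W M_F(t))² ≤ card² T ∫₀ᵀ ∫⁻ (W M_b(s))² ds` for
  every measurable weight `W` and every `t` (no gain, sup in time), and
  `lintegral_time_weight_majorant_forcing_sq_le` —
  `∫₀ᵀ ∫⁻ (‖η‖^{k+1} M_F(t))² dt ≤ card² (2c)⁻¹ T ∫₀ᵀ ∫⁻ (‖η‖^k M_b(s))² ds` (one power of `‖η‖`
  gained, `L²` in time), with `M_u(η) = ∑ⱼ ‖u η j‖ₑ`; and their forms under a sup-in-time bound on
  the force (`…_of_sup`), which is how `tao2011_smooth_local_existence_forced` states its hypothesis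
  (`sup_{t∈[0,T]} ‖f(t)‖_{H¹} ≤ B`, `‖f‖_{L¹_t H¹_x} ≤ B T`).

All statements are pure theorems (no definitions, no named facts); constants are written out.

## Mathlib / tree search

Tree (reused): `enorm_duhamel_le_lintegral`, `enorm_duhamel_sq_le` (`FourierL2Duhamel`),
`sq_lintegral_mul_le`, `measurable_ofReal_weight` (`FourierL2Convolution`), `aemeasurable_majorant`
(`FourierL2Nonlin`), `heat`, `clamp`, `HasDecay` and their algebra (`NSFourierPicard`,
`NSFourierBilinear`), `hasDecay_of_weight_mul_enorm_le` (`FourierL2PicardClass`). Mathlib: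
`intervalIntegral.continuous_parametric_intervalIntegral_of_continuous`,
`intervalIntegral.norm_integral_le_of_norm_le_const`, `intervalIntegral.integral_smul`,
`intervalIntegral.intervalIntegral_conj`, `ContinuousLinearMap.intervalIntegral_comp_comm`,
`MeasureTheory.lintegral_lintegral_swap`.

## References

* T. Tao, Anal. PDE 6 (2013) 25–107 = arXiv:1108.1165: (7) p. 3, Lemma 2.1 = arXiv Lemma 23
  (energy-duh2) p. 10, Thm. 5.4 = arXiv Thm. 31 (ii) p. 18 with the proof of Thm. 5.1 = arXiv
  Thm. 28 p. 16. [Tao2011]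
-/

noncomputable section

open MeasureTheory Set Function Filter Real Complex intervalIntegral
open scoped ENNReal NNReal ComplexConjugate
open _root_.Topology

namespace Literature.Analysis.FluidPDE.FourierNS

variable {ι : Type*} [Fintype ι]
variable {c T : ℝ} {b : ℝ → EuclideanSpace ℝ ι → ι → ℂ}

/-! ### Continuity -/

/-- The integrand of the forcing term is jointly continuous in `((t, ξ), s)` when `b` is jointly
continuous. [cite: Tao2011, Thm. 5.4 (ii) (arXiv Thm. 31), Duhamel formula (7)] -/
theorem continuous_forcing_integrand (hbc : Continuous (uncurry b)) :
    Continuous fun p : (ℝ × EuclideanSpace ℝ ι) × ℝ =>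
      heat c p.1.2 (clamp T p.1.1 - p.2) • b p.2 p.1.2 := by
  have hg : Continuous fun p : (ℝ × EuclideanSpace ℝ ι) × ℝ => clamp T p.1.1 - p.2 := by
    have := continuous_clamp T; fun_prop
  have h1 : Continuous fun p : (ℝ × EuclideanSpace ℝ ι) × ℝ => heat c p.1.2 (clamp T p.1.1 - p.2) :=
    continuous_heat_comp c (by fun_prop) hg
  have h2 : Continuous fun p : (ℝ × EuclideanSpace ℝ ι) × ℝ => b p.2 p.1.2 := by
    have : (fun p : (ℝ × EuclideanSpace ℝ ι) × ℝ => b p.2 p.1.2) = uncurry b ∘ fun p => (p.2, p.1.2) := rfl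
    rw [this]; exact hbc.comp (by fun_prop)
  exact h1.smul h2

/-- **The forcing term is jointly continuous on `ℝ × E`** (parametric interval integral of a
continuous integrand). [cite: Tao2011, Thm. 5.4 (ii) (arXiv Thm. 31), Duhamel formula (7)] -/
theorem continuous_forcing (hbc : Continuous (uncurry b)) : Continuous (uncurry (forcing c T b)) := by
  have h : Continuous fun p : ℝ × EuclideanSpace ℝ ι =>
      ∫ s in (0 : ℝ)..clamp T p.1, heat c p.2 (clamp T p.1 - s) • b s p.2 :=
    intervalIntegral.continuous_parametric_intervalIntegral_of_continuous (a₀ := 0)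
      (continuous_forcing_integrand hbc) ((continuous_clamp T).comp continuous_fst)
  have heq : uncurry (forcing c T b) = fun p : ℝ × EuclideanSpace ℝ ι =>
      ∫ s in (0 : ℝ)..clamp T p.1, heat c p.2 (clamp T p.1 - s) • b s p.2 := by
    funext p; rfl
  rw [heq]; exact h

/-- At fixed `(τ, ξ)` the integrand of the forcing term is continuous in `s`.
[cite: Tao2011, Thm. 5.4 (ii) (arXiv Thm. 31), Duhamel formula (7)] -/
theorem continuous_forcing_integrand_time (hbc : Continuous (uncurry b)) (τ : ℝ)
    (ξ : EuclideanSpace ℝ ι) : Continuous fun s : ℝ => heat c ξ (τ - s) • b s ξ := by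
  have hb : Continuous fun s : ℝ => b s ξ := by
    have : (fun s : ℝ => b s ξ) = uncurry b ∘ fun s => (s, ξ) := rfl
    rw [this]; exact hbc.comp (by fun_prop)
  exact (continuous_heat_comp c continuous_const (continuous_const.sub continuous_id)).smul hb

/-- The integrand of the forcing term is interval integrable in `s`.
[cite: Tao2011, Thm. 5.4 (ii) (arXiv Thm. 31), Duhamel formula (7)] -/
theorem intervalIntegrable_forcing_integrand (hbc : Continuous (uncurry b)) (τ : ℝ)
    (ξ : EuclideanSpace ℝ ι) (t₁ t₂ : ℝ) :
    IntervalIntegrable (fun s : ℝ => heat c ξ (τ - s) • b s ξ) volume t₁ t₂ :=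
  (continuous_forcing_integrand_time hbc τ ξ).intervalIntegrable _ _

/-- Time slices of the forcing term are continuous, hence measurable.
[cite: Tao2011, Thm. 5.4 (ii) (arXiv Thm. 31), Duhamel formula (7)] -/
theorem aestronglyMeasurable_forcing_slice (hbc : Continuous (uncurry b)) (t : ℝ) :
    AEStronglyMeasurable (forcing c T b t) volume :=
  ((continuous_forcing hbc).uncurry_left t).aestronglyMeasurable

/-- At a fixed frequency the forcing term is continuous in time.
[cite: Tao2011, Thm. 5.4 (ii) (arXiv Thm. 31), Duhamel formula (7)] -/
theorem continuous_forcing_time (hbc : Continuous (uncurry b)) (ξ : EuclideanSpace ℝ ι) :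
    Continuous fun t => forcing c T b t ξ := by
  have : (fun t => forcing c T b t ξ) = uncurry (forcing c T b) ∘ fun t => (t, ξ) := rfl
  rw [this]; exact (continuous_forcing hbc).comp (by fun_prop)

/-! ### Components, incompressibility and conjugation symmetry -/

/-- Components of the forcing term. [cite: Tao2011, Thm. 5.4 (ii) (arXiv Thm. 31), Duhamel formula (7)] -/
theorem forcing_apply (hbc : Continuous (uncurry b)) (t : ℝ) (ξ : EuclideanSpace ℝ ι) (l : ι) :
    forcing c T b t ξ l =
      ∫ s in (0 : ℝ)..clamp T t, (heat c ξ (clamp T t - s) : ℂ) * b s ξ l := by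
  have h := ((ContinuousLinearMap.proj (R := ℝ) (φ := fun _ : ι => ℂ) l).intervalIntegral_comp_comm
    (intervalIntegrable_forcing_integrand (c := c) hbc (clamp T t) ξ 0 (clamp T t)))
  simp only [ContinuousLinearMap.proj_apply, Pi.smul_apply, Complex.real_smul] at h
  rw [forcing, ← h]

/-- **The forcing term is divergence free on the Fourier side when the force coefficients are**:
`∑ₗ ξₗ F(t, ξ)ₗ = 0`. [cite: Tao2011, Thm. 5.4 (ii) (arXiv Thm. 31), Duhamel formula (7)] -/
theorem sum_mul_forcing (hbc : Continuous (uncurry b))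
    (hdiv : ∀ s ξ, ∑ l, ((ξ l : ℝ) : ℂ) * b s ξ l = 0) (t : ℝ) (ξ : EuclideanSpace ℝ ι) :
    ∑ l, ((ξ l : ℝ) : ℂ) * forcing c T b t ξ l = 0 := by
  have hii : ∀ l, IntervalIntegrable (fun s => ((ξ l : ℝ) : ℂ) * ((heat c ξ (clamp T t - s) : ℂ) *
      b s ξ l)) volume 0 (clamp T t) := fun l => by
    have := ((continuous_apply l).comp (continuous_forcing_integrand_time (c := c) hbc
      (clamp T t) ξ)).const_smul ((ξ l : ℝ) : ℂ)
    refine (this.intervalIntegrable _ _).congr fun s _ => ?_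
    simp [Complex.real_smul]
  have hz : ∀ s, ∑ l, ((ξ l : ℝ) : ℂ) * ((heat c ξ (clamp T t - s) : ℂ) * b s ξ l) = 0 :=
    fun s => by
    calc ∑ l, ((ξ l : ℝ) : ℂ) * ((heat c ξ (clamp T t - s) : ℂ) * b s ξ l)
        = (heat c ξ (clamp T t - s) : ℂ) * ∑ l, ((ξ l : ℝ) : ℂ) * b s ξ l := by
          rw [Finset.mul_sum]; congr 1 with l; ring
      _ = 0 := by rw [hdiv, mul_zero]
  simp_rw [forcing_apply hbc, ← intervalIntegral.integral_const_mul]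
  rw [← intervalIntegral.integral_finsetSum fun l _ => hii l]
  have : (fun s => ∑ l, ((ξ l : ℝ) : ℂ) * ((heat c ξ (clamp T t - s) : ℂ) * b s ξ l)) =
      fun _ => (0 : ℂ) := funext hz
  rw [this, intervalIntegral.integral_zero]

/-- **Conjugation symmetry of the forcing term**: if `b(s, -ξ) = conj b(s, ξ)` componentwise then
`F(t, -ξ) = conj F(t, ξ)` (the heat factor is real and even).
[cite: Tao2011, Thm. 5.4 (ii) (arXiv Thm. 31), Duhamel formula (7)] -/
theorem forcing_conj_symm (hbc : Continuous (uncurry b))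
    (hbs : ∀ s ξ l, b s (-ξ) l = conj (b s ξ l)) (t : ℝ) (ξ : EuclideanSpace ℝ ι) (l : ι) :
    forcing c T b t (-ξ) l = conj (forcing c T b t ξ l) := by
  rw [forcing_apply hbc, forcing_apply hbc, ← intervalIntegral.intervalIntegral_conj]
  congr 1 with s
  rw [map_mul, Complex.conj_ofReal, heat_neg, hbs]

/-! ### Pointwise decay of every order, uniformly in time -/

/-- **Pointwise bound of the forcing term**: for `c ≥ 0`, `T ≥ 0` and `‖b(s, ξ)‖ ≤ B (1+‖ξ‖)^{-K}`
for all `s`, `‖F(t, ξ)‖ ≤ T B (1+‖ξ‖)^{-K}` for every `t` (`|heat| ≤ 1` on the clamped time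
interval of length `≤ T`). [cite: Tao2011, Lemma 2.1 (arXiv Lemma 23), (energy-duh2)] -/
theorem norm_forcing_le (hc : 0 ≤ c) (hT : 0 ≤ T) {K : ℕ} {B : ℝ} (hb : ∀ s, HasDecay K B (b s))
    (t : ℝ) (ξ : EuclideanSpace ℝ ι) : ‖forcing c T b t ξ‖ ≤ T * B * ((1 + ‖ξ‖) ^ K)⁻¹ := by
  have hτ0 : 0 ≤ clamp T t := clamp_nonneg T t
  have hτT : clamp T t ≤ T := clamp_le hT t
  have hB : 0 ≤ B := (hb 0).nonneg
  have hbound : ∀ s ∈ Set.uIoc (0 : ℝ) (clamp T t), ‖heat c ξ (clamp T t - s) • b s ξ‖ ≤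
      B * ((1 + ‖ξ‖) ^ K)⁻¹ := by
    intro s hs
    rw [Set.uIoc_of_le hτ0] at hs
    rw [norm_smul, Real.norm_of_nonneg (heat_nonneg c ξ _)]
    calc heat c ξ (clamp T t - s) * ‖b s ξ‖ ≤ 1 * ‖b s ξ‖ := by
          gcongr; exact heat_le_one hc (by linarith [hs.2]) ξ
      _ = ‖b s ξ‖ := one_mul _
      _ ≤ B * ((1 + ‖ξ‖) ^ K)⁻¹ := (hb s).le ξ
  have h := intervalIntegral.norm_integral_le_of_norm_le_const hbound
  rw [sub_zero, abs_of_nonneg hτ0] at h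
  calc ‖forcing c T b t ξ‖ ≤ B * ((1 + ‖ξ‖) ^ K)⁻¹ * clamp T t := h
    _ ≤ B * ((1 + ‖ξ‖) ^ K)⁻¹ * T := mul_le_mul_of_nonneg_left hτT (by positivity)
    _ = T * B * ((1 + ‖ξ‖) ^ K)⁻¹ := by ring

/-- **`HasDecay` of the forcing term**: `HasDecay K B (b s)` for all `s` gives
`HasDecay K (T B) (F t)` for all `t` (`c, T ≥ 0`).
[cite: Tao2011, Lemma 2.1 (arXiv Lemma 23), (energy-duh2)] -/
theorem hasDecay_forcing (hc : 0 ≤ c) (hT : 0 ≤ T) {K : ℕ} {B : ℝ} (hb : ∀ s, HasDecay K B (b s))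
    (t : ℝ) : HasDecay K (T * B) (forcing c T b t) := fun ξ => norm_forcing_le hc hT hb t ξ

/-- **The forcing term has pointwise polynomial decay of every order, uniformly in time**, when
the force coefficients do (`c, T ≥ 0`): the qualitative class of the Duhamel parts of the
homogeneous Picard iterates (`FourierL2PicardClass`).
[cite: Tao2011, Thm. 5.4 (ii)+(iv) (arXiv Thm. 31)] -/
theorem exists_hasDecay_forcing (hc : 0 ≤ c) (hT : 0 ≤ T)
    (hb : ∀ K : ℕ, ∃ B : ℝ, ∀ s, HasDecay K B (b s)) (K : ℕ) :
    ∃ B : ℝ, ∀ t, HasDecay K B (forcing c T b t) := by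
  obtain ⟨B, hB⟩ := hb K
  exact ⟨T * B, hasDecay_forcing hc hT hB⟩

/-! ### Extended-norm bounds at a fixed frequency -/

/-- **`‖F(t, ξ)‖ₑ ≤ ∫⁻_{(0,T]} ‖b(s, ξ)‖ₑ ds`** (`c, T ≥ 0`; `|heat| ≤ 1` and the clamped time is at
most `T`). [cite: Tao2011, Lemma 2.1 (arXiv Lemma 23), (energy-duh2)] -/
theorem enorm_forcing_le_lintegral (hc : 0 ≤ c) (hT : 0 ≤ T) (t : ℝ) (ξ : EuclideanSpace ℝ ι) :
    ‖forcing c T b t ξ‖ₑ ≤ ∫⁻ s in Ioc 0 T, ‖b s ξ‖ₑ := by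
  rw [forcing]
  refine (enorm_duhamel_le_lintegral c ξ _ (clamp_nonneg T t)).trans ?_
  refine (setLIntegral_mono' measurableSet_Ioc fun s hs => ?_).trans (lintegral_mono_set
    (Ioc_subset_Ioc_right (clamp_le hT t)))
  calc ENNReal.ofReal (heat c ξ (clamp T t - s)) * ‖b s ξ‖ₑ ≤ 1 * ‖b s ξ‖ₑ := by
        gcongr
        rw [← ENNReal.ofReal_one]
        exact ENNReal.ofReal_le_ofReal (heat_le_one hc (by linarith [hs.2]) ξ)
    _ = _ := one_mul _

/-- **The heat gain of the forcing term**: for `c > 0`, `T ≥ 0`, `b` jointly continuous and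
`t ∈ [0, T]`,
`‖ξ‖² ‖F(t, ξ)‖ₑ² ≤ (2c)⁻¹ ∫⁻_{(0,T]} ‖b(s, ξ)‖ₑ² ds` — Cauchy–Schwarz in time against
`2c‖ξ‖² ∫₀ᵗ heat(t-s)² ds ≤ 1` (the tree's `enorm_duhamel_sq_le` applied to `‖ξ‖ • b`): the force term
of Tao's energy estimate recovers one derivative uniformly in the frequency.
[cite: Tao2011, Lemma 2.1 (arXiv Lemma 23), (energy-duh2)] -/
theorem norm_sq_mul_enorm_forcing_sq_le (hc : 0 < c) (hbc : Continuous (uncurry b))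
    {t : ℝ} (ht : t ∈ Icc 0 T) (ξ : EuclideanSpace ℝ ι) :
    ENNReal.ofReal (‖ξ‖ ^ 2) * ‖forcing c T b t ξ‖ₑ ^ 2 ≤
      ENNReal.ofReal (1 / (2 * c)) * ∫⁻ s in Ioc 0 T, ‖b s ξ‖ₑ ^ 2 := by
  have hN : ∀ s ∈ Icc 0 T, ‖(‖ξ‖ : ℝ) • b s ξ‖ₑ ≤ ENNReal.ofReal ‖ξ‖ * ‖b s ξ‖ₑ := fun s _ => by
    rw [enorm_smul, Real.enorm_eq_ofReal (norm_nonneg ξ)]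
  have hbs : Continuous fun s : ℝ => b s ξ := by
    have : (fun s : ℝ => b s ξ) = uncurry b ∘ fun s => (s, ξ) := rfl
    rw [this]; exact hbc.comp (by fun_prop)
  have hφ : AEMeasurable (fun s => ‖b s ξ‖ₑ) (volume.restrict (Ioc 0 T)) :=
    hbs.measurable.enorm.aemeasurable
  have h := enorm_duhamel_sq_le (T := T) (ξ := ξ) (N := fun s => (‖ξ‖ : ℝ) • b s ξ)
    (φ := fun s => ‖b s ξ‖ₑ) hc hφ hN ht
  have heq : ∫ s in (0 : ℝ)..t, heat c ξ (t - s) • ((‖ξ‖ : ℝ) • b s ξ) =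
      (‖ξ‖ : ℝ) • forcing c T b t ξ := by
    rw [forcing, clamp_of_mem ht, ← intervalIntegral.integral_smul]
    congr 1
    funext s
    rw [smul_comm]
  rw [heq, enorm_smul, Real.enorm_eq_ofReal (norm_nonneg ξ), mul_pow,
    ← ENNReal.ofReal_pow (norm_nonneg ξ)] at h
  exact h

/-! ### The majorant of the forcing term -/

/-- The sup norm of a finite family is at most the sum of the norms of its entries, in `ℝ≥0∞`
form. [folklore] -/
private theorem enorm_pi_le_majorant (x : ι → ℂ) : ‖x‖ₑ ≤ ∑ j, ‖x j‖ₑ := by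
  have h : ‖x‖ ≤ ∑ j, ‖x j‖ :=
    (pi_norm_le_iff_of_nonneg (Finset.sum_nonneg fun j _ => norm_nonneg (x j))).2 fun j =>
      Finset.single_le_sum (f := fun j => ‖x j‖) (fun j _ => norm_nonneg (x j)) (Finset.mem_univ j)
  calc ‖x‖ₑ = ENNReal.ofReal ‖x‖ := (ofReal_norm x).symm
    _ ≤ ENNReal.ofReal (∑ j, ‖x j‖) := ENNReal.ofReal_le_ofReal h
    _ = ∑ j, ENNReal.ofReal ‖x j‖ := ENNReal.ofReal_sum_of_nonneg fun j _ => norm_nonneg (x j)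
    _ = ∑ j, ‖x j‖ₑ := Finset.sum_congr rfl fun j _ => ofReal_norm (x j)

/-- An entry of a finite family is bounded by the sup norm, in `ℝ≥0∞` form. [folklore] -/
private theorem enorm_apply_le_enorm_pi (x : ι → ℂ) (j : ι) : ‖x j‖ₑ ≤ ‖x‖ₑ := by
  rw [← ofReal_norm, ← ofReal_norm]
  exact ENNReal.ofReal_le_ofReal (norm_le_pi_norm x j)

/-- **The majorant of the forcing term**: `∑ⱼ ‖F(t, η)ⱼ‖ₑ ≤ card ι · ∫⁻_{(0,T]} ∑ⱼ ‖b(s, η)ⱼ‖ₑ ds`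
(`c, T ≥ 0`). [cite: Tao2011, Lemma 2.1 (arXiv Lemma 23), (energy-duh2)] -/
theorem majorant_forcing_le (hc : 0 ≤ c) (hT : 0 ≤ T) (t : ℝ) (η : EuclideanSpace ℝ ι) :
    (∑ j, ‖forcing c T b t η j‖ₑ) ≤
      (Fintype.card ι : ℝ≥0∞) * ∫⁻ s in Ioc 0 T, ∑ j, ‖b s η j‖ₑ := by
  calc (∑ j, ‖forcing c T b t η j‖ₑ) ≤ ∑ _j : ι, ∫⁻ s in Ioc 0 T, ∑ j, ‖b s η j‖ₑ := by
        refine Finset.sum_le_sum fun j _ => ?_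
        exact ((enorm_apply_le_enorm_pi _ j).trans (enorm_forcing_le_lintegral hc hT t η)).trans
          (lintegral_mono fun s => enorm_pi_le_majorant (b s η))
    _ = (Fintype.card ι : ℝ≥0∞) * ∫⁻ s in Ioc 0 T, ∑ j, ‖b s η j‖ₑ := by
        simp [Finset.sum_const, Finset.card_univ]

/-! ### Measurability of the force majorant -/

/-- The weighted majorant `(s, η) ↦ (W η ∑ⱼ ‖b(s, η)ⱼ‖ₑ)²` of a jointly continuous `b` is jointly
measurable (product of a measurable weight with a continuous function). [folklore] -/
private theorem aemeasurable_weight_majorant_sq (hbc : Continuous (uncurry b))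
    {W : EuclideanSpace ℝ ι → ℝ≥0∞} (hW : Measurable W) (μ ν : Measure ℝ) (hν : ν ≪ μ)
    (hμ : μ = volume) :
    AEMeasurable (uncurry fun (η : EuclideanSpace ℝ ι) (s : ℝ) => (W η * ∑ j, ‖b s η j‖ₑ) ^ 2)
      ((volume : Measure (EuclideanSpace ℝ ι)).prod ν) := by
  subst hμ
  have hM : Measurable (uncurry fun (η : EuclideanSpace ℝ ι) (s : ℝ) => ∑ j, ‖b s η j‖ₑ) := by
    refine Finset.measurable_sum _ fun j _ => ?_
    have : (fun p : EuclideanSpace ℝ ι × ℝ => b p.2 p.1 j) =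
        (fun z : ι → ℂ => z j) ∘ uncurry b ∘ fun p => (p.2, p.1) := rfl
    change Measurable fun p : EuclideanSpace ℝ ι × ℝ => ‖b p.2 p.1 j‖ₑ
    rw [show (fun p : EuclideanSpace ℝ ι × ℝ => ‖b p.2 p.1 j‖ₑ) =
      (fun z => ‖z‖ₑ) ∘ fun p : EuclideanSpace ℝ ι × ℝ => b p.2 p.1 j from rfl, this]
    exact measurable_enorm.comp (((continuous_apply j).comp (hbc.comp (by fun_prop))).measurable)
  have h : Measurable (uncurry fun (η : EuclideanSpace ℝ ι) (s : ℝ) => (W η * ∑ j, ‖b s η j‖ₑ) ^ 2) :=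
    ((hW.comp measurable_fst).mul hM).pow_const 2
  exact h.aemeasurable

/-! ### Integrated bounds: the forcing quantities of the `X¹/X²` recursion -/

/-- `(∫⁻_{(0,T]} g)² ≤ T ∫⁻_{(0,T]} g²` (Cauchy–Schwarz in time). [folklore] -/
private theorem sq_setLIntegral_Ioc_le {g : ℝ → ℝ≥0∞}
    (hg : AEMeasurable g (volume.restrict (Ioc 0 T))) :
    (∫⁻ s in Ioc 0 T, g s) ^ 2 ≤ ENNReal.ofReal T * ∫⁻ s in Ioc 0 T, g s ^ 2 := by
  have h := sq_lintegral_mul_le (volume.restrict (Ioc 0 T)) (f := fun _ => (1 : ℝ≥0∞)) (g := g)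
    aemeasurable_const hg
  simp only [one_mul, one_pow, lintegral_const, Measure.restrict_apply_univ, Real.volume_Ioc,
    sub_zero] at h
  simpa only [one_mul] using h

/-- **Sup-in-time moments of the forcing term (no gain).** For `c, T ≥ 0`, `b` jointly continuous
and a measurable weight `W`, for every `t`,
`∫⁻ (W η ∑ⱼ‖F(t,η)ⱼ‖ₑ)² dη ≤ card² · T · ∫₀ᵀ ∫⁻ (W η ∑ⱼ‖b(s,η)ⱼ‖ₑ)² dη ds`
(`∑ⱼ‖Fⱼ‖ₑ ≤ card ∫⁻‖b‖ₑ`, Cauchy–Schwarz in time, Tonelli) — the `L^∞_t H^s`-half of (energy-duh2)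
for the force term, with `‖b‖_{L¹_t} ≤ T^{1/2}‖b‖_{L²_t}`.
[cite: Tao2011, Lemma 2.1 (arXiv Lemma 23), (energy-duh2)] -/
theorem lintegral_weight_majorant_forcing_sq_le (hc : 0 ≤ c) (hT : 0 ≤ T)
    (hbc : Continuous (uncurry b)) {W : EuclideanSpace ℝ ι → ℝ≥0∞} (hW : Measurable W) (t : ℝ) :
    ∫⁻ η, (W η * ∑ j, ‖forcing c T b t η j‖ₑ) ^ 2 ≤
      (Fintype.card ι : ℝ≥0∞) ^ 2 * ENNReal.ofReal T *
        ∫⁻ s in Ioc 0 T, ∫⁻ η, (W η * ∑ j, ‖b s η j‖ₑ) ^ 2 := by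
  set Mb : ℝ → EuclideanSpace ℝ ι → ℝ≥0∞ := fun s η => ∑ j, ‖b s η j‖ₑ with hMb
  have hMbm : ∀ η, AEMeasurable (fun s => Mb s η) (volume.restrict (Ioc 0 T)) := fun η => by
    refine Finset.aemeasurable_fun_sum _ fun j _ => ?_
    have : (fun s : ℝ => b s η j) = (fun z : ι → ℂ => z j) ∘ uncurry b ∘ fun s => (s, η) := rfl
    have hc' : Continuous fun s : ℝ => b s η j := by
      rw [this]; exact (continuous_apply j).comp (hbc.comp (by fun_prop))
    exact hc'.measurable.enorm.aemeasurable
  -- pointwise bound in `η`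
  have hpt : ∀ η, (W η * ∑ j, ‖forcing c T b t η j‖ₑ) ^ 2 ≤
      (Fintype.card ι : ℝ≥0∞) ^ 2 * ENNReal.ofReal T * ∫⁻ s in Ioc 0 T, (W η * Mb s η) ^ 2 := by
    intro η
    calc (W η * ∑ j, ‖forcing c T b t η j‖ₑ) ^ 2
        ≤ (W η * ((Fintype.card ι : ℝ≥0∞) * ∫⁻ s in Ioc 0 T, Mb s η)) ^ 2 := by
          gcongr; exact majorant_forcing_le hc hT t η
      _ = (Fintype.card ι : ℝ≥0∞) ^ 2 * (W η * ∫⁻ s in Ioc 0 T, Mb s η) ^ 2 := by ring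
      _ = (Fintype.card ι : ℝ≥0∞) ^ 2 * (∫⁻ s in Ioc 0 T, W η * Mb s η) ^ 2 := by
          rw [lintegral_const_mul'' _ (hMbm η)]
      _ ≤ (Fintype.card ι : ℝ≥0∞) ^ 2 * (ENNReal.ofReal T * ∫⁻ s in Ioc 0 T, (W η * Mb s η) ^ 2) := by
          gcongr; exact sq_setLIntegral_Ioc_le ((hMbm η).const_mul _)
      _ = _ := by ring
  -- integrate and swap
  have hsw := lintegral_lintegral_swap (μ := (volume : Measure (EuclideanSpace ℝ ι)))
    (ν := volume.restrict (Ioc 0 T)) (f := fun η s => (W η * Mb s η) ^ 2)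
    (aemeasurable_weight_majorant_sq hbc hW volume (volume.restrict (Ioc 0 T))
      Measure.restrict_le_self.absolutelyContinuous rfl)
  calc ∫⁻ η, (W η * ∑ j, ‖forcing c T b t η j‖ₑ) ^ 2
      ≤ ∫⁻ η, (Fintype.card ι : ℝ≥0∞) ^ 2 * ENNReal.ofReal T * ∫⁻ s in Ioc 0 T, (W η * Mb s η) ^ 2 :=
        lintegral_mono hpt
    _ = (Fintype.card ι : ℝ≥0∞) ^ 2 * ENNReal.ofReal T * ∫⁻ η, ∫⁻ s in Ioc 0 T, (W η * Mb s η) ^ 2 :=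
        lintegral_const_mul' _ _ (ENNReal.mul_ne_top (by simp) ENNReal.ofReal_ne_top)
    _ = (Fintype.card ι : ℝ≥0∞) ^ 2 * ENNReal.ofReal T * ∫⁻ s in Ioc 0 T, ∫⁻ η, (W η * Mb s η) ^ 2 := by
        rw [hsw]

/-- **Sup-in-time moments of the forcing term under a sup bound on the force**: if
`∫⁻ (W η ∑ⱼ‖b(s,η)ⱼ‖ₑ)² ≤ β` for `s ∈ (0, T]` then `∫⁻ (W η ∑ⱼ‖F(t,η)ⱼ‖ₑ)² ≤ card² T² β` for
every `t` (`‖f‖_{L¹_t H^s} ≤ T sup_t ‖f(t)‖_{H^s}`).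
[cite: Tao2011, Lemma 2.1 (arXiv Lemma 23), (energy-duh2)] -/
theorem lintegral_weight_majorant_forcing_sq_le_of_sup (hc : 0 ≤ c) (hT : 0 ≤ T)
    (hbc : Continuous (uncurry b)) {W : EuclideanSpace ℝ ι → ℝ≥0∞} (hW : Measurable W) {β : ℝ≥0∞}
    (hβ : ∀ s ∈ Ioc 0 T, ∫⁻ η, (W η * ∑ j, ‖b s η j‖ₑ) ^ 2 ≤ β) (t : ℝ) :
    ∫⁻ η, (W η * ∑ j, ‖forcing c T b t η j‖ₑ) ^ 2 ≤
      (Fintype.card ι : ℝ≥0∞) ^ 2 * ENNReal.ofReal T ^ 2 * β := by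
  refine (lintegral_weight_majorant_forcing_sq_le hc hT hbc hW t).trans ?_
  have h : ∫⁻ s in Ioc 0 T, ∫⁻ η, (W η * ∑ j, ‖b s η j‖ₑ) ^ 2 ≤ ENNReal.ofReal T * β :=
    calc ∫⁻ s in Ioc 0 T, ∫⁻ η, (W η * ∑ j, ‖b s η j‖ₑ) ^ 2 ≤ ∫⁻ _s in Ioc 0 T, β :=
          setLIntegral_mono' measurableSet_Ioc fun s hs => hβ s hs
      _ = ENNReal.ofReal T * β := by rw [setLIntegral_const, Real.volume_Ioc, sub_zero, mul_comm]
  calc (Fintype.card ι : ℝ≥0∞) ^ 2 * ENNReal.ofReal T * ∫⁻ s in Ioc 0 T, ∫⁻ η, (W η * ∑ j, ‖b s η j‖ₑ) ^ 2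
      ≤ (Fintype.card ι : ℝ≥0∞) ^ 2 * ENNReal.ofReal T * (ENNReal.ofReal T * β) :=
        mul_le_mul' le_rfl h
    _ = _ := by ring

/-- **`L²`-in-time moments of the forcing term with the heat gain.** For `c > 0`, `T ≥ 0`, `b`
jointly continuous and every `k`,
`∫₀ᵀ ∫⁻ (‖η‖^{k+1} ∑ⱼ‖F(t,η)ⱼ‖ₑ)² dη dt ≤ card² (2c)⁻¹ T ∫₀ᵀ ∫⁻ (‖η‖^k ∑ⱼ‖b(s,η)ⱼ‖ₑ)² dη ds`:
at each frequency `‖η‖²‖F(t,η)‖ₑ² ≤ (2c)⁻¹∫⁻‖b(s,η)‖ₑ²ds` uniformly in `t ∈ [0,T]`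
(`norm_sq_mul_enorm_forcing_sq_le`), then integrate over `t` and `η` (Tonelli) — the
`L²_t H^{s+1}`-half of (energy-duh2) for the force term.
[cite: Tao2011, Lemma 2.1 (arXiv Lemma 23), (energy-duh2)] -/
theorem lintegral_time_weight_majorant_forcing_sq_le (hc : 0 < c)
    (hbc : Continuous (uncurry b)) (k : ℕ) :
    ∫⁻ t in Ioc 0 T, ∫⁻ η, (ENNReal.ofReal (‖η‖ ^ (k + 1)) * ∑ j, ‖forcing c T b t η j‖ₑ) ^ 2 ≤
      (Fintype.card ι : ℝ≥0∞) ^ 2 * ENNReal.ofReal (1 / (2 * c)) * ENNReal.ofReal T *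
        ∫⁻ s in Ioc 0 T, ∫⁻ η, (ENNReal.ofReal (‖η‖ ^ k) * ∑ j, ‖b s η j‖ₑ) ^ 2 := by
  set Mb : ℝ → EuclideanSpace ℝ ι → ℝ≥0∞ := fun s η => ∑ j, ‖b s η j‖ₑ with hMb
  set C : ℝ≥0∞ := (Fintype.card ι : ℝ≥0∞) ^ 2 * ENNReal.ofReal (1 / (2 * c)) with hC
  have hWk : Measurable fun η : EuclideanSpace ℝ ι => ENNReal.ofReal (‖η‖ ^ k) :=
    (ENNReal.continuous_ofReal.comp (continuous_norm.pow k)).measurable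
  have hMbm : ∀ η, AEMeasurable (fun s => (ENNReal.ofReal (‖η‖ ^ k) * Mb s η) ^ 2)
      (volume.restrict (Ioc 0 T)) := fun η => by
    refine ((Finset.aemeasurable_fun_sum _ fun j _ => ?_).const_mul _).pow_const 2
    have : (fun s : ℝ => b s η j) = (fun z : ι → ℂ => z j) ∘ uncurry b ∘ fun s => (s, η) := rfl
    have hc' : Continuous fun s : ℝ => b s η j := by rw [this]; exact (continuous_apply j).comp (hbc.comp (by fun_prop))
    exact hc'.measurable.enorm.aemeasurable
  -- the time-uniform pointwise bound at each frequency
  have hpt : ∀ t ∈ Icc 0 T, ∀ η,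
      (ENNReal.ofReal (‖η‖ ^ (k + 1)) * ∑ j, ‖forcing c T b t η j‖ₑ) ^ 2 ≤
        C * ∫⁻ s in Ioc 0 T, (ENNReal.ofReal (‖η‖ ^ k) * Mb s η) ^ 2 := by
    intro t ht η
    have hgain := norm_sq_mul_enorm_forcing_sq_le (b := b) hc hbc ht η
    have hsplit : ENNReal.ofReal (‖η‖ ^ (k + 1)) = ENNReal.ofReal (‖η‖ ^ k) * ENNReal.ofReal ‖η‖ := by
      rw [← ENNReal.ofReal_mul (by positivity), pow_succ]
    calc (ENNReal.ofReal (‖η‖ ^ (k + 1)) * ∑ j, ‖forcing c T b t η j‖ₑ) ^ 2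
        ≤ (ENNReal.ofReal (‖η‖ ^ (k + 1)) * ((Fintype.card ι : ℝ≥0∞) * ‖forcing c T b t η‖ₑ)) ^ 2 := by
          gcongr
          calc (∑ j, ‖forcing c T b t η j‖ₑ) ≤ ∑ _j : ι, ‖forcing c T b t η‖ₑ :=
                Finset.sum_le_sum fun j _ => enorm_apply_le_enorm_pi _ j
            _ = (Fintype.card ι : ℝ≥0∞) * ‖forcing c T b t η‖ₑ := by
                simp [Finset.sum_const, Finset.card_univ]
      _ = (Fintype.card ι : ℝ≥0∞) ^ 2 * ENNReal.ofReal (‖η‖ ^ k) ^ 2 *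
          (ENNReal.ofReal ‖η‖ ^ 2 * ‖forcing c T b t η‖ₑ ^ 2) := by rw [hsplit]; ring
      _ = (Fintype.card ι : ℝ≥0∞) ^ 2 * ENNReal.ofReal (‖η‖ ^ k) ^ 2 *
          (ENNReal.ofReal (‖η‖ ^ 2) * ‖forcing c T b t η‖ₑ ^ 2) := by
          rw [← ENNReal.ofReal_pow (norm_nonneg η)]
      _ ≤ (Fintype.card ι : ℝ≥0∞) ^ 2 * ENNReal.ofReal (‖η‖ ^ k) ^ 2 *
          (ENNReal.ofReal (1 / (2 * c)) * ∫⁻ s in Ioc 0 T, ‖b s η‖ₑ ^ 2) := by gcongr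
      _ = C * (ENNReal.ofReal (‖η‖ ^ k) ^ 2 * ∫⁻ s in Ioc 0 T, ‖b s η‖ₑ ^ 2) := by rw [hC]; ring
      _ = C * ∫⁻ s in Ioc 0 T, ENNReal.ofReal (‖η‖ ^ k) ^ 2 * ‖b s η‖ₑ ^ 2 := by
          rw [lintegral_const_mul' _ _ (ENNReal.pow_ne_top ENNReal.ofReal_ne_top)]
      _ ≤ C * ∫⁻ s in Ioc 0 T, (ENNReal.ofReal (‖η‖ ^ k) * Mb s η) ^ 2 := by
          gcongr with s
          rw [mul_pow]
          gcongr
          exact enorm_pi_le_majorant (b s η)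
  -- integrate over `t`, then swap `η` and `s`
  have hsw := lintegral_lintegral_swap (μ := (volume : Measure (EuclideanSpace ℝ ι)))
    (ν := volume.restrict (Ioc 0 T)) (f := fun η s => (ENNReal.ofReal (‖η‖ ^ k) * Mb s η) ^ 2)
    (aemeasurable_weight_majorant_sq hbc hWk volume (volume.restrict (Ioc 0 T))
      Measure.restrict_le_self.absolutelyContinuous rfl)
  calc ∫⁻ t in Ioc 0 T, ∫⁻ η, (ENNReal.ofReal (‖η‖ ^ (k + 1)) * ∑ j, ‖forcing c T b t η j‖ₑ) ^ 2
      ≤ ∫⁻ _t in Ioc 0 T, ∫⁻ η, C * ∫⁻ s in Ioc 0 T, (ENNReal.ofReal (‖η‖ ^ k) * Mb s η) ^ 2 :=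
        setLIntegral_mono' measurableSet_Ioc fun t ht => lintegral_mono (hpt t ⟨ht.1.le, ht.2⟩)
    _ = ENNReal.ofReal T * (C * ∫⁻ η, ∫⁻ s in Ioc 0 T, (ENNReal.ofReal (‖η‖ ^ k) * Mb s η) ^ 2) := by
        rw [setLIntegral_const, Real.volume_Ioc, sub_zero, mul_comm, lintegral_const_mul' _ _ ?_]
        exact ENNReal.mul_ne_top (by simp) ENNReal.ofReal_ne_top
    _ = C * ENNReal.ofReal T * ∫⁻ s in Ioc 0 T, ∫⁻ η, (ENNReal.ofReal (‖η‖ ^ k) * Mb s η) ^ 2 := by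
        rw [hsw]; ring
    _ = _ := by rw [hC]

/-- **`L²`-in-time moments of the forcing term under a sup bound on the force**: if
`∫⁻ (‖η‖^k ∑ⱼ‖b(s,η)ⱼ‖ₑ)² ≤ β` for `s ∈ (0, T]` then
`∫₀ᵀ ∫⁻ (‖η‖^{k+1} ∑ⱼ‖F(t,η)ⱼ‖ₑ)² ≤ card² (2c)⁻¹ T² β`.
[cite: Tao2011, Lemma 2.1 (arXiv Lemma 23), (energy-duh2)] -/
theorem lintegral_time_weight_majorant_forcing_sq_le_of_sup (hc : 0 < c)
    (hbc : Continuous (uncurry b)) (k : ℕ) {β : ℝ≥0∞}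
    (hβ : ∀ s ∈ Ioc 0 T, ∫⁻ η, (ENNReal.ofReal (‖η‖ ^ k) * ∑ j, ‖b s η j‖ₑ) ^ 2 ≤ β) :
    ∫⁻ t in Ioc 0 T, ∫⁻ η, (ENNReal.ofReal (‖η‖ ^ (k + 1)) * ∑ j, ‖forcing c T b t η j‖ₑ) ^ 2 ≤
      (Fintype.card ι : ℝ≥0∞) ^ 2 * ENNReal.ofReal (1 / (2 * c)) * ENNReal.ofReal T ^ 2 * β := by
  refine (lintegral_time_weight_majorant_forcing_sq_le hc hbc k).trans ?_
  have h : ∫⁻ s in Ioc 0 T, ∫⁻ η, (ENNReal.ofReal (‖η‖ ^ k) * ∑ j, ‖b s η j‖ₑ) ^ 2 ≤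
      ENNReal.ofReal T * β :=
    calc ∫⁻ s in Ioc 0 T, ∫⁻ η, (ENNReal.ofReal (‖η‖ ^ k) * ∑ j, ‖b s η j‖ₑ) ^ 2
        ≤ ∫⁻ _s in Ioc 0 T, β := setLIntegral_mono' measurableSet_Ioc fun s hs => hβ s hs
      _ = ENNReal.ofReal T * β := by rw [setLIntegral_const, Real.volume_Ioc, sub_zero, mul_comm]
  calc (Fintype.card ι : ℝ≥0∞) ^ 2 * ENNReal.ofReal (1 / (2 * c)) * ENNReal.ofReal T *
        ∫⁻ s in Ioc 0 T, ∫⁻ η, (ENNReal.ofReal (‖η‖ ^ k) * ∑ j, ‖b s η j‖ₑ) ^ 2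
      ≤ (Fintype.card ι : ℝ≥0∞) ^ 2 * ENNReal.ofReal (1 / (2 * c)) * ENNReal.ofReal T *
        (ENNReal.ofReal T * β) := mul_le_mul' le_rfl h
    _ = _ := by ring

end Literature.Analysis.FluidPDE.FourierNS

end
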